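import Literature.MathematicalPhysics.QuantumFieldTheory.Balaban1983to89.T3AlphaInputsACTwoRun
import Literature.MathematicalPhysics.QuantumFieldTheory.Balaban1983to89.T4PairDerivBridge
import HarnessLib

/-!
# `Balaban1983to89.T3AlphaInputsACTwoRunLevel` — rung R3, crux «FluctuationComparisonRegPr» (stmt-QuantumFields-19201): ERRATUM to the two-run schema
# `T3AlphaInputsACTwoRun.PolymerCauchyBgAt` (the cut-off comparison rate sits on the LEVEL counted from the cut-off, [King1986] Prop. 3.9), the block-volume
# clause of the localisation domains, the corrected bundle `TwoRunLv`, and the elementary facts about the gauge-orbit sup-distance `orbitDistOn`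
# (hypothesis schemas over exposed data, never asserted; the lemmas are bookkeeping)

Fleet seat `ym-ust-19201-p2` (gen 2, socket pen; FINDING-19201-SE2-scaling, evidence on stmt-QuantumFields-19201).  WHY AN ERRATUM.  `PolymerCauchyBgAt D b₀ p₀ C68 κ₁ a C`
(p459737) bounds the matched difference of the level-`i` interaction term (`i = 1+j` in run `K`, `i+1` in run `K+1`; `k = K − n` steps above the comparison height `n`)
by `C·e^{−κ₁𝓛(Y)}·θ(n)²·L^{−4(k−i)}·R` with `R = L^{−a(K−1−j)} = L^{−a(K−i)}`.  Print puts the rate on the OTHER index: [King1986] Prop. 3.9 (3.73)–(3.74) p.665 bounds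
the scale-`j` slice comparison by `C·L^{−γk}·(Lʲη)^{2−d−γ}` = (natural size) × `L^{−γj}`, `j` counted from the FINEST scale, and p.675 «When j = 0, we bound each term
separately using Proposition 3.7, and write the factor η^{2−d} as L^{−γk}L^{−k(2−d−γ)}» (no cancellation at the finest slice; the growth `(Lʲη)^{−γ}` is paid by the
positive degree of subgraphs, p.665).  So the King-faithful per-level rate is `L^{−a·i}`: `O(1)` relative precision at the lattice-scale levels (tiny terms, many of
them, superrenormalisable weight `L^{−(k−i)}` after counting) and `L^{−a·k}` at the top.  As typed, `R = L^{−a(K−i)}` over-demands the low levels (relative precision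
`L^{−a(K−1)}` at `i = 1`, undischargeable) and under-powers the top one (`L^{−a⌊K/m⌋}`, whose level total `∝ θ(n)²L^{(3−a)n}` is not summable for `a < 2`).  Files are
append-only and `PolymerCauchyBgAt` stays as a record; the S-E″ bookkeeping (`Summit.….LogComparisonLevelCauchy`) consumes THIS file's `PolymerCauchyLvAt`.

* §1 `orbitDistOn_nonneg`, `orbitDistOn_le_two`, `orbitDistOn_mono` (the infimum is over a non-empty set bounded below: the trivial gauge transformation and
  `dist1 ≤ 2` on `SU(2)`, `T4PairDerivBridge.dist1_le_two_specialUnitaryGroup`).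
* §2 `PolymerCauchyLvAt D b₀ p₀ C68 κ₁ a C` — `PolymerCauchyBgAt` with the rate factor `(((F.L:ℝ)^(1+j))⁻¹)^a`; `LocBlockVolume D` — every listed level-`i` localisation
  domain has at least `L^{3i}` fine sites ((24) p.262 «connected unions of big blocks»; the count the S-E″ summation needs, cf. `sum_loc_exp_le_of_locCover_of_volume`
  p460845); the bundle `TwoRunLv D b₀ p₀ C68 a` (= `TwoRun` with `PolymerCauchyLvAt` for `PolymerCauchyBgAt`, plus `LocBlockVolume`).

References: C. King, CMP 102 (1986) 649–677 [King1986] (Thm 3.4 (3.9) p.656, Prop. 3.9 (3.73)–(3.75) p.665, p.675); T. Bałaban, CMP 102 (1985) 255–275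
[Balaban1985UV3] ((24)–(25) p.262, (43)–(46) pp.266–267); T. Bałaban, CMP 98 (1985) 17–51 [Balaban1985Averaging] ((8) p.19).
-/

noncomputable section

open MeasureTheory
open Literature.MathematicalPhysics.QuantumFieldTheory.Balaban1983to89.T3ContinuumYM3Torus
open Literature.MathematicalPhysics.QuantumFieldTheory.Balaban1983to89.T3UnitLawDensityEML (ℰp)
open Literature.MathematicalPhysics.QuantumFieldTheory.Balaban1983to89.T3UnitScaleTilt
open Literature.MathematicalPhysics.QuantumFieldTheory.Balaban1983to89.T3LevelShift
open Literature.MathematicalPhysics.QuantumFieldTheory.Balaban1983to89.T3AlphaInputsAC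
open Literature.MathematicalPhysics.QuantumFieldTheory.Balaban1983to89.T3AlphaPolymerSocket
open Literature.MathematicalPhysics.QuantumFieldTheory.Balaban1983to89.T3AlphaInputsACTwoRun

namespace Literature.MathematicalPhysics.QuantumFieldTheory.Balaban1983to89.T3AlphaInputsACTwoRunLevel

/-! ## §1 The gauge-orbit sup-distance: non-negative, at most `2`, monotone in the bond set -/

section OrbitDist

variable (F : T3Family) {K : ℕ}

/-- The set of admissible radii in the definition of `orbitDistOn` (bookkeeping abbreviation, not a new notion). [cite: Balaban1985Averaging, (8) p.19] -/
def radii (S : Set (PBond (F.P K) 0)) (U U' : GaugeField (F.P K) 0 (Matrix.specialUnitaryGroup (Fin 2) ℂ)) : Set ℝ :=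
  {d : ℝ | 0 ≤ d ∧ ∃ u : GaugeTransf (F.P K) 0 (Matrix.specialUnitaryGroup (Fin 2) ℂ),
    ∀ b ∈ S, GaugeGroup.dist1 (GaugeField.gaugeAct u U b * (U' b)⁻¹) ≤ d}

/-- `orbitDistOn` is the infimum of `radii` (definitional). [cite: Balaban1985Averaging, (8) p.19] -/
theorem orbitDistOn_eq_sInf (S : Set (PBond (F.P K) 0)) (U U' : GaugeField (F.P K) 0 (Matrix.specialUnitaryGroup (Fin 2) ℂ)) :
    orbitDistOn F S U U' = sInf (radii F S U U') :=
  rfl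

/-- The radius `2` is admissible for every bond set (trivial gauge transformation; `dist1 ≤ 2` on `SU(2)`). [cite: Balaban1985Averaging, (8) p.19] -/
theorem two_mem_radii (S : Set (PBond (F.P K) 0)) (U U' : GaugeField (F.P K) 0 (Matrix.specialUnitaryGroup (Fin 2) ℂ)) :
    (2 : ℝ) ∈ radii F S U U' :=
  ⟨by norm_num, fun _ => 1, fun b _ => T4PairDerivBridge.dist1_le_two_specialUnitaryGroup _⟩

/-- `radii` is bounded below by `0`. [cite: Balaban1985Averaging, (8) p.19] -/
theorem bddBelow_radii (S : Set (PBond (F.P K) 0)) (U U' : GaugeField (F.P K) 0 (Matrix.specialUnitaryGroup (Fin 2) ℂ)) :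
    BddBelow (radii F S U U') :=
  ⟨0, fun _ hd => hd.1⟩

/-- **`0 ≤ orbitDistOn`**. [cite: Balaban1985Averaging, (8) p.19] -/
theorem orbitDistOn_nonneg (S : Set (PBond (F.P K) 0)) (U U' : GaugeField (F.P K) 0 (Matrix.specialUnitaryGroup (Fin 2) ℂ)) :
    0 ≤ orbitDistOn F S U U' :=
  Real.sInf_nonneg fun _ hd => hd.1

/-- **`orbitDistOn ≤ 2`** (the distance is a genuine infimum over a non-empty set). [cite: Balaban1985Averaging, (8) p.19] -/
theorem orbitDistOn_le_two (S : Set (PBond (F.P K) 0)) (U U' : GaugeField (F.P K) 0 (Matrix.specialUnitaryGroup (Fin 2) ℂ)) :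
    orbitDistOn F S U U' ≤ 2 :=
  csInf_le (bddBelow_radii F S U U') (two_mem_radii F S U U')

/-- **MONOTONICITY IN THE BOND SET**: `S ⊆ S′ ⇒ orbitDistOn S ≤ orbitDistOn S′` (a gauge transformation good for `S′` is good for `S`). In particular the distance on
print's enlargement `bondsIn 0 (enl K i Y)` is at most the distance on the whole torus, which `MinimiserCauchyAt` controls. [cite: Balaban1985Averaging, (8) p.19] -/
theorem orbitDistOn_mono {S S' : Set (PBond (F.P K) 0)} (h : S ⊆ S') (U U' : GaugeField (F.P K) 0 (Matrix.specialUnitaryGroup (Fin 2) ℂ)) :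
    orbitDistOn F S U U' ≤ orbitDistOn F S' U U' :=
  csInf_le_csInf (bddBelow_radii F S U U') ⟨2, two_mem_radii F S' U U'⟩ fun _ hd => ⟨hd.1, hd.2.imp fun _ hu b hb => hu b (h hb)⟩

end OrbitDist

/-! ## §2 The corrected per-polymer comparison schema, the block-volume clause, the corrected two-run bundle (never asserted) -/

section Schemas

variable {F : T3Family} {γ : ℝ}

/-- **THE CUT-OFF COMPARISON OF THE LOCALISED TERMS AT THE CANONICAL MATCHED BACKGROUND, KING-FAITHFUL SCALING** (hypothesis schema, never asserted;
ERRATUM-replacement of `T3AlphaInputsACTwoRun.PolymerCauchyBgAt`; m-FREE; exponent `a`, decay rate `κ₁`, constant `C` are PARAMETERS): background-independent shifts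
`c K n j Y` such that for every cut-off `K`, height `n ≤ K`, step `j < K − n`, every fine background `U′` of run `K+1` in the regular window of height `n` ((68):
`|U′(∂q) − 1| ≤ C68·θ(n)·L^{−2(K+1−n)}`) and every run-`K` localisation domain `Y` of level `1+j` at the trivial history,
`|Pterm (K+1) (2+j) (refineSet F K Y) U′ − Pterm K (1+j) Y (coarsenField F K U′) − c K n j Y| ≤ C·e^{−κ₁𝓛(Y)}·θ(n)²·L^{−4(K−n−1−j)}·(L^{−(1+j)})^{a}` — the printed
size (44) of the term times the RELATIVE lattice artefact `L^{−a·i}` of a level-`i` object (`i = 1+j` steps above the cut-off): [King1986] Prop. 3.9 (3.74) p.665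
«C L^{−γk}(Lʲη)^{2−d−γ}», i.e. natural size × `L^{−γj}` with `j` counted from the finest scale, and p.675 «When j = 0, we bound each term separately».  Located,
unprinted for non-abelian d = 3 (King's model is the abelian Higgs model). [cite: King1986, Prop. 3.9 (3.73)-(3.74) p.665] -/
def PolymerCauchyLvAt (D : AlphaDataT3 F γ) (b₀ p₀ C68 κ₁ a C : ℝ) : Prop :=
  ∃ c : (K n j : ℕ) → Set (Site (F.P K) 0) → ℝ,
    ∀ (K n : ℕ), n ≤ K → ∀ j : ℕ, j < K - n →
      ∀ U' : GaugeField (F.P (K + 1)) 0 (Matrix.specialUnitaryGroup (Fin 2) ℂ),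
        (∀ q : Plaq (F.P (K + 1)) 0,
          GaugeGroup.dist1 (GaugeField.plaqHol U' q) ≤ C68 * θBal F.L γ b₀ p₀ n * (((F.L : ℝ) ^ (K + 1 - n))⁻¹) ^ 2) →
        ∀ Y ∈ D.Loc K (K - n) (D.triv K (K - n)) (1 + j), |D.Pterm (K + 1) (1 + (j + 1)) (refineSet F K Y) U' -
            D.Pterm K (1 + j) Y (coarsenField F K U') - c K n j Y| ≤
            C * Real.exp (-κ₁ * D.treeLen K (1 + j) Y) * θBal F.L γ b₀ p₀ n ^ 2 *
              (((F.L : ℝ) ^ (K - n - 1 - j))⁻¹) ^ 4 * (((F.L : ℝ) ^ (1 + j))⁻¹) ^ a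

/-- **EVERY LISTED LOCALISATION DOMAIN HAS THE VOLUME OF A BIG BLOCK** (hypothesis schema, never asserted): a level-`i` localisation domain of run `K` contains at least
`L^{3i}` sites of the fine torus (stated as `L^{3i} ≤ Σ_y 1_Y(y)`, the form `Summit.….sum_loc_exp_le_of_locCover_of_volume` consumes) — [Balaban1985UV3] (24) p.262
«Localizations X are connected unions of big blocks» of the `Lⁱη`-lattice, each big block having `(M₁Lⁱ)³ ≥ L^{3i}` fine sites (`M₁ ≥ 1`); in particular no listed domain
is empty.  Together with `LocCover` it makes `Σ_{Y ∈ Loc K j h i} e^{−κ₁𝓛(Y)}` of the order of the number of level-`i` blocks, (45)–(46) p.267. [cite: Balaban1985UV3, (24) p.262] -/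
def LocBlockVolume (D : AlphaDataT3 F γ) : Prop :=
  ∀ K j (h : D.Hist K j) i, ∀ Y ∈ D.Loc K j h i, (F.L : ℝ) ^ (3 * i) ≤ ∑ y : Site (F.P K) 0, Y.indicator (fun _ => (1 : ℝ)) y

/-- **THE CORRECTED TWO-RUN BUNDLE delivered WITH a constructed datum** (= `T3AlphaInputsACTwoRun.TwoRun` with `PolymerCauchyLvAt` in place of `PolymerCauchyBgAt`, plus
the block-volume clause): at ONE decay rate `κ₁` — the printed size of the terms, summable localisation domains, block volume, Lipschitz dependence on the background,
matched domains across the two cut-offs, and the per-polymer comparison at the canonical matched background with exponent `a` (window constant `C68` = the one of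
`Regularity68`). [cite: Balaban1985UV3, (43)-(46) pp.266-267] -/
def TwoRunLv (D : AlphaDataT3 F γ) (b₀ p₀ C68 a : ℝ) : Prop :=
  ∃ κ₁ : ℝ, (∃ C : ℝ, TermSize D b₀ p₀ C κ₁) ∧ (∃ C' : ℝ, LocCover D κ₁ C') ∧ LocBlockVolume D ∧
    (∃ CL α₁ t₀ : ℝ, 0 < t₀ ∧ PtermLipschitz D CL κ₁ α₁ t₀) ∧ LocMatched D ∧ (∃ C : ℝ, PolymerCauchyLvAt D b₀ p₀ C68 κ₁ a C)

/-- Under `LocBlockVolume` no listed localisation domain is empty. [cite: Balaban1985UV3, (24) p.262] -/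
theorem LocBlockVolume.nonempty {D : AlphaDataT3 F γ} (h : LocBlockVolume D) {K j : ℕ} {hh : D.Hist K j} {i : ℕ} {Y : Set (Site (F.P K) 0)}
    (hY : Y ∈ D.Loc K j hh i) : Y.Nonempty := by
  by_contra hne
  rw [Set.not_nonempty_iff_eq_empty] at hne
  have hle := h K j hh i Y hY
  rw [hne] at hle
  simp only [Set.indicator_empty, Finset.sum_const_zero] at hle
  have hL : (0 : ℝ) < (F.L : ℝ) ^ (3 * i) := pow_pos (by have := F.hL.2; exact_mod_cast (by omega : 0 < F.L)) _
  linarith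

end Schemas

/-! ## §3 (appended 2026-08-27, FINDING-19201-e1-scaling) The FOLDED two-run schema AT THE TWO RUNS' TRIVIAL-HISTORY MINIMISERS, the trivial-history
size row on the datum window, and the bundle `TwoRunMin` — hypothesis schemas over exposed data, never asserted

WHY A FOLDED FORM.  The three-piece route of §2 (`PolymerCauchyLvAt` at the canonical matched background + `PtermLipschitz` + the route-level minimiser
closeness `T3AlphaInputsACTwoRun.MinimiserCauchyAt`) consumes `MinimiserCauchyAt` in its GLOBAL form: the gauge-orbit sup-distance of the two runs' minimisers ON
THE WHOLE FINE TORUS bounded by the CURVATURE scale `θ(n)·L^{−2k}` times a rate `L^{−a₁k}`.  A connection-level sup-distance is generically one factor `Lᵏ` above the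
curvature-level one (optimal gauges integrate the curvature difference over the region), and print's two-cut-off rate for the minimiser/interpolation operators
is a RELATIVE `L^{−γk}` at the FIELD level ([King1986] Prop. 3.8 (3.71) p.664 «Proposition 3.8 gives the desired factor L^{−γk}», `0 < γ < 1`): the global form
asks `θL^{−2k}L^{−a₁k}` where print delivers `≈ θL^{−k}L^{−γk}` locally and more globally — undischargeable as typed.  What the S-E″ bookkeeping actually needs is
only the per-polymer comparison of the two runs' terms AT THEIR OWN trivial-history minimisers, with the King-faithful rate; on a level-`i` localisation domain the
local connection distance `θL^{−2k}L^{−γk}·(M₁Lⁱ·(𝓛(Y)+r))` times the ξ-scaling `Lⁱ` is `θM₁(𝓛+r)·L^{−2(k−i)}·L^{−γk}` — of the shape below with `κ₁` slightly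
lowered.  So the folded schema `PolymerCauchyMinAt` is dischargeable where print is, and S-E″ from it is PURE COUNTING (no guard, no threshold, no minimiser
analysis on the consumer side: `Summit.….LogComparisonLevelCauchyMin`).  The size row is stated on the datum WINDOW at the trivial history (`TermSizeTriv`: exactly
what the consumer reads; implied by the package's `Adm`-conditioned `TermSize` through `AdmOnSmall`, `Summit.….LogComparisonPolymerEstimate.abs_pterm_umin_triv_le`,
and unaffected by the `Adm`-semantics question F-α1-3 of ★pub-balaban3d-alpha-1). -/

section Folded

variable {F : T3Family} {γ : ℝ}

/-- **THE CUT-OFF COMPARISON OF THE LOCALISED TERMS AT THE TWO RUNS' TRIVIAL-HISTORY MINIMISERS** (hypothesis schema, never asserted; m-FREE; decay rate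
`κ₁`, exponent `a`, constant `C` are PARAMETERS): datum-independent shifts `c K n j Y` such that for every cut-off `K`, height `n ≤ K`, step `j < K − n`
(level `i = 1+j`), every `θ(n)`-small datum `V` of the comparison lattice and every run-`K` localisation domain `Y` of level `i` at the trivial history,
`|𝒫′_{i+1}(refineSet Y, U′_{k+1}(V)) − 𝒫_i(Y, U_k(V)) − c K n j Y| ≤ C·e^{−κ₁𝓛(Y)}·θ(n)²·L^{−4(k−i)}·(L^{−i})^{a}` — `U_k(V)`, `U′_{k+1}(V)` the two runs'
trivial-history composite minimisers read on their towers (`fieldShift`), the printed size (44) of the term times the relative lattice artefact `L^{−a·i}`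
of a level-`i` object: [King1986] Prop. 3.9 (3.74) p.665 for the slices («C·L^{−γk}(Lʲη)^{2−d−γ}», rate `L^{−γj}` in the slice index from the finest scale,
p.675 «When j = 0, we bound each term separately») and Prop. 3.8 (3.71) p.664 for the interpolation operators (the minimisers' share, relative `L^{−γk} ≤
L^{−γi}`).  Located, unprinted for non-abelian d = 3. [cite: King1986, Prop. 3.8-3.9 (3.71)-(3.74) pp.664-665] -/
def PolymerCauchyMinAt (D : AlphaDataT3 F γ) (b₀ p₀ κ₁ a C : ℝ) : Prop :=
  ∃ c : (K n j : ℕ) → Set (Site (F.P K) 0) → ℝ,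
    ∀ (K n : ℕ) (h : n ≤ K), ∀ j : ℕ, j < K - n →
      ∀ V : GaugeField (F.P n) 0 (Matrix.specialUnitaryGroup (Fin 2) ℂ), PlaqSmall (θBal F.L γ b₀ p₀ n) V →
        ∀ Y ∈ D.Loc K (K - n) (D.triv K (K - n)) (1 + j),
          |D.Pterm (K + 1) (1 + (j + 1)) (refineSet F K Y) (D.Umin (K + 1) (K + 1 - n) (D.triv (K + 1) (K + 1 - n))
              (fieldShift (F.sitesPerDir_eq (m := F.m) (K := K + 1) (j := K + 1 - n) (m' := F.m) (K' := n) (j' := 0) (by omega)) V)) -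
            D.Pterm K (1 + j) Y (D.Umin K (K - n) (D.triv K (K - n))
              (fieldShift (F.sitesPerDir_eq (m := F.m) (K := K) (j := K - n) (m' := F.m) (K' := n) (j' := 0) (by omega)) V)) -
            c K n j Y| ≤
          C * Real.exp (-κ₁ * D.treeLen K (1 + j) Y) * θBal F.L γ b₀ p₀ n ^ 2 *
            (((F.L : ℝ) ^ (K - n - 1 - j))⁻¹) ^ 4 * (((F.L : ℝ) ^ (1 + j))⁻¹) ^ a

/-- **THE PRINTED SIZE (44) OF THE TRIVIAL-HISTORY TERMS ON THE DATUM WINDOW** (hypothesis schema, never asserted; the form the 19201 consumer reads —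
implied by `TermSize` ∧ `AdmOnSmall` for the window `PlaqSmall (θ(n)) V`): for `n ≤ K`, a `θ(n)`-small datum `V`, a level `1 ≤ i ≤ K − n` and `Y ∈ Loc`,
`|𝒫_i(Y, U_k(V))| ≤ C·e^{−κ₁𝓛(Y)}·θ(n+1)²·L^{−4(k−i)}` — (44) p.267 «|𝒫_j(Y_j, U_k)| ≤ O(1)·Π exp(…)·8L²B₃g_{k−1}p(g_{k−1})(Lʲη)²» at the trivial history.
[cite: Balaban1985UV3, (44) p.267] -/
def TermSizeTriv (D : AlphaDataT3 F γ) (b₀ p₀ C κ₁ : ℝ) : Prop :=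
  0 < κ₁ ∧ ∀ (K n : ℕ) (h : n ≤ K) (V : GaugeField (F.P n) 0 (Matrix.specialUnitaryGroup (Fin 2) ℂ)), PlaqSmall (θBal F.L γ b₀ p₀ n) V →
    ∀ i, 1 ≤ i → i ≤ K - n → ∀ Y ∈ D.Loc K (K - n) (D.triv K (K - n)) i,
      |D.Pterm K i Y (D.Umin K (K - n) (D.triv K (K - n))
          (fieldShift (F.sitesPerDir_eq (m := F.m) (K := K) (j := K - n) (m' := F.m) (K' := n) (j' := 0) (by omega)) V))| ≤
        C * Real.exp (-κ₁ * D.treeLen K i Y) * θBal F.L γ b₀ p₀ (n + 1) ^ 2 * (((F.L : ℝ) ^ (K - n - i))⁻¹) ^ 4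

/-- **THE FOLDED TWO-RUN BUNDLE delivered WITH a constructed datum**: at ONE decay rate `κ₁` — the printed size of the trivial-history terms on the window,
summable localisation domains, block volume, matched domains across the two cut-offs, and the per-polymer comparison at the two runs' trivial-history minimisers
with exponent `a`.  S-E″ from it is pure counting (`Summit.….LogComparisonLevelCauchyMin.cauchyAtHeights_of_twoRunMin`): no `C68`, no `ε₀`, no minimiser schema on
the consumer side. [cite: Balaban1985UV3, (43)-(46) pp.266-267] -/
def TwoRunMin (D : AlphaDataT3 F γ) (b₀ p₀ a : ℝ) : Prop :=
  ∃ κ₁ : ℝ, (∃ C : ℝ, TermSizeTriv D b₀ p₀ C κ₁) ∧ (∃ C' : ℝ, LocCover D κ₁ C') ∧ LocBlockVolume D ∧ LocMatched D ∧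
    ∃ C : ℝ, PolymerCauchyMinAt D b₀ p₀ κ₁ a C

end Folded

/-! ## §4 (appended 2026-08-27; ★pub-balaban3d-alpha-1 F-α1-5 and its request of 2026-08-27T00:59Z; fleet seat ym-ust-19201-p2 gen 4) THE TRIVIAL-HISTORY TERM
SOCKETS OVER A COARSE-FIELD-INDEXED TERM FUNCTION — the lane's data model — and the identification of §3 as their special case

WHY.  The interface's interaction terms `Pterm K i Y U` are functionals of a FINE configuration `U`, and every 19201/19935 socket reads them at the trivial-history
composite minimiser `U = Umin K j triv W`; the only object any consumer (the (43)-decomposition, the size row, the two-run row, the S-E″ bookkeeping) ever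
evaluates is the COMPOSITE `(K, j, i, Y, W) ↦ Pterm K i Y (Umin K j triv W)` — a function of the level-`j` field `W`.  The lane `pub-balaban3d` carries its
(43)-terms in exactly that currency (★alpha-1 F-α1-5: `Carriers.StepSeries.oldVal/PY/PYZ/act` are indexed by (history, level-`(k+1)` field), the minimiser
dependence sitting INSIDE the chart data `Bcfg` of (27)/(43)), so it cannot honestly instantiate a fine-field `Pterm`; and in the registered STUB 3′ of line v5h
(`∃ D, RepAtHeights D … ∧ PintDecomp D ∧ TwoRunMin D …`) the field `Umin` is otherwise unconstrained, so the factorisation through `Umin` carries no force there.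
This section restates the trivial-history term sockets over an ARBITRARY term function `PT : TermFn F` and records that the §3 schemas and
`T3AlphaPolymerSocket.PolymerCauchyAt` ARE these at `PT := ptermMin D` (`Iff.rfl`), and that `PintDecomp D` gives the trivial-history decomposition for `ptermMin D`.
Consumer: `Summit.….LogComparisonLevelCauchyMinT` (S-E″ from `PintDecompTrivT ∧ TwoRunMinT`, pure counting).  Hypothesis schemas over exposed data, never asserted. -/

section CoarseIndexed

variable {F : T3Family} {γ : ℝ}

/-- **COARSE-FIELD-INDEXED TRIVIAL-HISTORY TERM FUNCTIONS** of a family: `PT K j i Y W` = the level-`i` interaction term of the localisation domain `Y` in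
run `K`'s level-`j` effective action at the trivial history, as a function of the level-`j` field `W` — (43) p.266 «Σ_{j=1}^{k} Σ_{Y_j} 𝒫_j(Y_j, U_k)» with
`U_k = U_k(V)` substituted.  A function type; nothing asserted. [cite: Balaban1985UV3, (43) p.266] -/
abbrev TermFn (F : T3Family) : Type :=
  (K j i : ℕ) → Set (Site (F.P K) 0) → GaugeField (F.P K) j (Matrix.specialUnitaryGroup (Fin 2) ℂ) → ℝ

/-- **THE INTERFACE'S OWN TERM FUNCTION**: `ptermMin D K j i Y W := Pterm K i Y (Umin K j triv W)` — the fine-field terms of `D` read at the level-`j`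
trivial-history composite minimiser ((41)/(43) p.266 at `U_k = U_k(V)`, `h = triv`). [cite: Balaban1985UV3, (41) and (43) p.266] -/
def ptermMin (D : AlphaDataT3 F γ) : TermFn F :=
  fun K j i Y W => D.Pterm K i Y (D.Umin K j (D.triv K j) W)

/-- `ptermMin` unfolds (definitional). [cite: Balaban1985UV3, (43) p.266] -/
theorem ptermMin_apply (D : AlphaDataT3 F γ) (K j i : ℕ) (Y : Set (Site (F.P K) 0))
    (W : GaugeField (F.P K) j (Matrix.specialUnitaryGroup (Fin 2) ℂ)) :
    ptermMin D K j i Y W = D.Pterm K i Y (D.Umin K j (D.triv K j) W) :=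
  rfl

/-- **(43) AT THE TRIVIAL HISTORY OVER A TERM FUNCTION** (hypothesis schema, never asserted): `Pint K j triv W = Σ_{i=1}^{j} Σ_{Y ∈ Loc K j triv i} PT K j i Y W`
for every run, level and field — (41)/(43) p.266 «Σ_{j=1}^{k} Σ_{Y_j} 𝒫_j(Y_j, U_k)» at the trivial history (the only history the 19201/19935 sockets read; the
lane's honest instance is the re-indexing of `Carriers.pintOfSeries = PoldIn + PY + PYZ`). [cite: Balaban1985UV3, (41) and (43) p.266] -/
def PintDecompTrivT (D : AlphaDataT3 F γ) (PT : TermFn F) : Prop :=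
  ∀ K j (W : GaugeField (F.P K) j (Matrix.specialUnitaryGroup (Fin 2) ℂ)),
    D.Pint K j (D.triv K j) W = ∑ i ∈ Finset.Icc 1 j, ∑ Y ∈ D.Loc K j (D.triv K j) i, PT K j i Y W

/-- **THE PRINTED SIZE (44) OF THE TRIVIAL-HISTORY TERMS ON THE DATUM WINDOW, OVER A TERM FUNCTION** (hypothesis schema, never asserted; = §3 `TermSizeTriv`
with `Pterm K i Y (Umin K (K−n) triv ·)` replaced by `PT K (K−n) i Y ·`): for `n ≤ K`, a `θ(n)`-small datum `V`, a level `1 ≤ i ≤ K − n` and `Y ∈ Loc`,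
`|PT K (K−n) i Y V| ≤ C·e^{−κ₁𝓛(Y)}·θ(n+1)²·L^{−4(K−n−i)}` — (44) p.267 at the trivial history. [cite: Balaban1985UV3, (44) p.267] -/
def TermSizeTrivT (D : AlphaDataT3 F γ) (PT : TermFn F) (b₀ p₀ C κ₁ : ℝ) : Prop :=
  0 < κ₁ ∧ ∀ (K n : ℕ) (h : n ≤ K) (V : GaugeField (F.P n) 0 (Matrix.specialUnitaryGroup (Fin 2) ℂ)), PlaqSmall (θBal F.L γ b₀ p₀ n) V →
    ∀ i, 1 ≤ i → i ≤ K - n → ∀ Y ∈ D.Loc K (K - n) (D.triv K (K - n)) i,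
      |PT K (K - n) i Y (fieldShift (F.sitesPerDir_eq (m := F.m) (K := K) (j := K - n) (m' := F.m) (K' := n) (j' := 0) (by omega)) V)| ≤
        C * Real.exp (-κ₁ * D.treeLen K i Y) * θBal F.L γ b₀ p₀ (n + 1) ^ 2 * (((F.L : ℝ) ^ (K - n - i))⁻¹) ^ 4

/-- **THE CUT-OFF COMPARISON OF THE LOCALISED TERMS OF THE TWO RUNS AT THE SAME DATUM, OVER A TERM FUNCTION** (hypothesis schema, never asserted; m-FREE;
= §3 `PolymerCauchyMinAt` with both minimiser-composites replaced by the term function read at the common datum `V` of the comparison lattice): datum-independent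
shifts `c K n j Y` such that for every cut-off `K`, height `n ≤ K`, step `j < K − n` (level `i = 1+j`), every `θ(n)`-small `V` and every run-`K` domain `Y` of level `i`
at the trivial history, `|PT′ (K+1) (K+1−n) (i+1) (refineSet Y) V − PT K (K−n) i Y V − c K n j Y| ≤ C·e^{−κ₁𝓛(Y)}·θ(n)²·L^{−4(K−n−i)}·(L^{−i})^{a}` — the printed size
(44) of the term times the relative lattice artefact of a level-`i` object: [King1986] Prop. 3.9 (3.74) p.665 (slices, rate in the slice index from the finest scale,
p.675 «When j = 0, we bound each term separately») and Prop. 3.8 (3.71) p.664 (the minimisers' share).  Located, UNPRINTED for non-abelian d = 3.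
[cite: King1986, Prop. 3.8-3.9 (3.71)-(3.74) pp.664-665] -/
def PolymerCauchyMinAtT (D : AlphaDataT3 F γ) (PT : TermFn F) (b₀ p₀ κ₁ a C : ℝ) : Prop :=
  ∃ c : (K n j : ℕ) → Set (Site (F.P K) 0) → ℝ,
    ∀ (K n : ℕ) (h : n ≤ K), ∀ j : ℕ, j < K - n →
      ∀ V : GaugeField (F.P n) 0 (Matrix.specialUnitaryGroup (Fin 2) ℂ), PlaqSmall (θBal F.L γ b₀ p₀ n) V →
        ∀ Y ∈ D.Loc K (K - n) (D.triv K (K - n)) (1 + j),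
          |PT (K + 1) (K + 1 - n) (1 + (j + 1)) (refineSet F K Y)
              (fieldShift (F.sitesPerDir_eq (m := F.m) (K := K + 1) (j := K + 1 - n) (m' := F.m) (K' := n) (j' := 0) (by omega)) V) -
            PT K (K - n) (1 + j) Y
              (fieldShift (F.sitesPerDir_eq (m := F.m) (K := K) (j := K - n) (m' := F.m) (K' := n) (j' := 0) (by omega)) V) -
            c K n j Y| ≤
          C * Real.exp (-κ₁ * D.treeLen K (1 + j) Y) * θBal F.L γ b₀ p₀ n ^ 2 *
            (((F.L : ℝ) ^ (K - n - 1 - j))⁻¹) ^ 4 * (((F.L : ℝ) ^ (1 + j))⁻¹) ^ a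

/-- **THE FOLDED TWO-RUN BUNDLE OVER A TERM FUNCTION** (= §3 `TwoRunMin` with the two term rows over `PT`; the three geometric clauses `LocCover`, `LocBlockVolume`,
`LocMatched` concern `Loc`/`treeLen` only and are unchanged): at ONE decay rate `κ₁` — the printed size of the trivial-history terms on the window, summable
localisation domains, block volume, matched domains across the two cut-offs, and the per-polymer two-run comparison with exponent `a`.
[cite: Balaban1985UV3, (43)-(46) pp.266-267] -/
def TwoRunMinT (D : AlphaDataT3 F γ) (PT : TermFn F) (b₀ p₀ a : ℝ) : Prop :=
  ∃ κ₁ : ℝ, (∃ C : ℝ, TermSizeTrivT D PT b₀ p₀ C κ₁) ∧ (∃ C' : ℝ, LocCover D κ₁ C') ∧ LocBlockVolume D ∧ LocMatched D ∧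
    ∃ C : ℝ, PolymerCauchyMinAtT D PT b₀ p₀ κ₁ a C

/-- **THE CUT-OFF-CAUCHY PROPERTY, POLYMER BY POLYMER, OVER A TERM FUNCTION** (hypothesis schema, never asserted; = `T3AlphaPolymerSocket.PolymerCauchyAt` with the
minimiser-composites replaced by `PT` at the common datum; the m-dependent socket the S-E″ bookkeeping produces from `TwoRunMinT`): per-polymer budgets `η K j Y ≥ 0`
and shifts `c K j Y` for the MATCHED terms (run `K+1`, level `K+1−⌊K/m⌋`, term level `2+j`, domain `refineSet Y` vs run `K`, level `K−⌊K/m⌋`, term level `1+j`,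
domain `Y`), a budget `δ₀ K ≥ 0` with shift `c₀ K` for run `K+1`'s extra finest term level, summability of the total budget, and the a.e. inequalities on the
`θ(⌊K/m⌋)`-small data with both restricted height densities positive. [cite: King1986, Prop. 3.8-3.9 pp.664-665] -/
def PolymerCauchyAtT (D : AlphaDataT3 F γ) (PT : TermFn F) (b₀ p₀ : ℝ) (m : ℕ) : Prop :=
  ∃ (η c : (K j : ℕ) → Set (Site (F.P K) 0) → ℝ) (δ₀ c₀ : ℕ → ℝ),
    (∀ K j Y, 0 ≤ η K j Y) ∧ (∀ K, 0 ≤ δ₀ K) ∧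
    (Summable fun K : ℕ => δ₀ K +
      ∑ j ∈ Finset.range (K - K / m), ∑ Y ∈ D.Loc K (K - K / m) (D.triv K (K - K / m)) (1 + j), η K j Y) ∧
    (∀ K, ∀ᵐ V ∂fieldMeasure (F.P (K / m)) 0 (Matrix.specialUnitaryGroup (Fin 2) ℂ),
      PlaqSmall (θBal F.L γ b₀ p₀ (K / m)) V →
        0 < T3TiltDescent.heightDensity F γ (Nat.div_le_self K m) (histGood F ℰp (θBal F.L γ b₀ p₀) K (K / m)) V →
        0 < T3TiltDescent.heightDensity F γ ((Nat.div_le_self K m).trans (Nat.le_succ K))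
              (histGood F ℰp (θBal F.L γ b₀ p₀) (K + 1) (K / m)) V →
          |(∑ Y ∈ D.Loc (K + 1) (K + 1 - K / m) (D.triv (K + 1) (K + 1 - K / m)) 1,
              PT (K + 1) (K + 1 - K / m) 1 Y
                (fieldShift (F.sitesPerDir_eq (m := F.m) (K := K + 1) (j := K + 1 - K / m) (m' := F.m) (K' := K / m) (j' := 0)
                  (by have := Nat.div_le_self K m; omega)) V)) -
            c₀ K| ≤ δ₀ K) ∧
    (∀ K, ∀ j < K - K / m, ∀ Y ∈ D.Loc K (K - K / m) (D.triv K (K - K / m)) (1 + j),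
      ∀ᵐ V ∂fieldMeasure (F.P (K / m)) 0 (Matrix.specialUnitaryGroup (Fin 2) ℂ),
        PlaqSmall (θBal F.L γ b₀ p₀ (K / m)) V →
          0 < T3TiltDescent.heightDensity F γ (Nat.div_le_self K m) (histGood F ℰp (θBal F.L γ b₀ p₀) K (K / m)) V →
          0 < T3TiltDescent.heightDensity F γ ((Nat.div_le_self K m).trans (Nat.le_succ K))
                (histGood F ℰp (θBal F.L γ b₀ p₀) (K + 1) (K / m)) V →
            |PT (K + 1) (K + 1 - K / m) (1 + (j + 1)) (refineSet F K Y)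
                (fieldShift (F.sitesPerDir_eq (m := F.m) (K := K + 1) (j := K + 1 - K / m) (m' := F.m) (K' := K / m) (j' := 0)
                  (by have := Nat.div_le_self K m; omega)) V) -
              PT K (K - K / m) (1 + j) Y
                (fieldShift (F.sitesPerDir_eq (m := F.m) (K := K) (j := K - K / m) (m' := F.m) (K' := K / m) (j' := 0)
                  (by have := Nat.div_le_self K m; omega)) V) -
              c K j Y| ≤ η K j Y)

/-! ### The §3 schemas and `T3AlphaPolymerSocket.PolymerCauchyAt` are the term-function schemas at `ptermMin D` -/

/-- `TermSizeTriv D` IS `TermSizeTrivT D (ptermMin D)` (definitional). [cite: Balaban1985UV3, (44) p.267] -/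
theorem termSizeTrivT_ptermMin_iff (D : AlphaDataT3 F γ) (b₀ p₀ C κ₁ : ℝ) :
    TermSizeTrivT D (ptermMin D) b₀ p₀ C κ₁ ↔ TermSizeTriv D b₀ p₀ C κ₁ :=
  Iff.rfl

/-- `PolymerCauchyMinAt D` IS `PolymerCauchyMinAtT D (ptermMin D)` (definitional). [cite: King1986, Prop. 3.8-3.9 (3.71)-(3.74) pp.664-665] -/
theorem polymerCauchyMinAtT_ptermMin_iff (D : AlphaDataT3 F γ) (b₀ p₀ κ₁ a C : ℝ) :
    PolymerCauchyMinAtT D (ptermMin D) b₀ p₀ κ₁ a C ↔ PolymerCauchyMinAt D b₀ p₀ κ₁ a C :=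
  Iff.rfl

/-- `TwoRunMin D` IS `TwoRunMinT D (ptermMin D)` (definitional). [cite: Balaban1985UV3, (43)-(46) pp.266-267] -/
theorem twoRunMinT_ptermMin_iff (D : AlphaDataT3 F γ) (b₀ p₀ a : ℝ) :
    TwoRunMinT D (ptermMin D) b₀ p₀ a ↔ TwoRunMin D b₀ p₀ a :=
  Iff.rfl

/-- `T3AlphaPolymerSocket.PolymerCauchyAt D` IS `PolymerCauchyAtT D (ptermMin D)` (definitional). [cite: King1986, Prop. 3.8-3.9 pp.664-665] -/
theorem polymerCauchyAtT_ptermMin_iff (D : AlphaDataT3 F γ) (b₀ p₀ : ℝ) (m : ℕ) :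
    PolymerCauchyAtT D (ptermMin D) b₀ p₀ m ↔ PolymerCauchyAt D b₀ p₀ m :=
  Iff.rfl

/-- The interface's (43)-clause `PintDecomp D` (all histories, fine-field terms) gives the trivial-history decomposition over `ptermMin D`.
[cite: Balaban1985UV3, (41) and (43) p.266] -/
theorem pintDecompTrivT_ptermMin_of_pintDecomp {D : AlphaDataT3 F γ} (h : PintDecomp D) : PintDecompTrivT D (ptermMin D) :=
  fun K j W => h K j (D.triv K j) W

end CoarseIndexed

end Literature.MathematicalPhysics.QuantumFieldTheory.Balaban1983to89.T3AlphaInputsACTwoRunLevel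

end
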